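import Literature.Geometry.Riemannian.MCFReparametrization
import HarnessLib

/-!
# Local reparametrisation invariance of the mean curvature

Topic `Literature/Geometry/Riemannian`.  The tree's `meanCurvature_comp_diffeomorph`
(`MCFReparametrization.lean`) is stated for global diffeomorphisms of hypersurface parameter
manifolds modelled on `𝓡 n`.  Its proof is pointwise, and we record the general local form needed
to compare two parametrisations of the same embedded piece of submanifold (e.g. a slice of a
parametric flow `F_t : M → V` and its local graph parametrisation over a tilted plane, White 2005
§8.4): for ANY model spaces, a map `Ψ : N → X` differentiable at an interior point `u` whose
differential `dΨ_u` is bijective, a spacelike immersion `f : X → M'` with `f ∘ Ψ` a spacelike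
immersion, and a field `ν` along `f` differentiable at `Ψ u`,

  `H_{f ∘ Ψ, ν ∘ Ψ}(u) = H_{f, ν}(Ψ u)`      (`meanCurvature_comp_right_of_bijective`).

Everything is PROVED; no definitions, no named facts.

## References

* B. O'Neill, *Semi-Riemannian Geometry*, Academic Press 1983, Ch. 4, Lemma 4.4 ff. (the shape
  operator is tensorial). [ONeill1983]
* B. White, *A local regularity theorem for mean curvature flow*, Ann. of Math. 161 (2005), §8.4.
  [White2005]
-/

noncomputable section

open Bundle Set Function Module
open scoped Manifold ContDiff Topology

namespace Literature.Geometry.Riemannian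

open Literature.Geometry.Lorentzian Literature.Geometry.Lorentzian.PseudoRiemannianMetric

variable {E : Type*} [NormedAddCommGroup E] [NormedSpace ℝ E] {H : Type*} [TopologicalSpace H]
  {I : ModelWithCorners ℝ E H} {M : Type*} [TopologicalSpace M] [ChartedSpace H M]
  [IsManifold I ∞ M] [FiniteDimensional ℝ E] {n : ℕ∞ω}
  (g : PseudoRiemannianMetric I n E (TangentSpace I : M → Type _)) [g.HasLeviCivita]
  {EX : Type*} [NormedAddCommGroup EX] [NormedSpace ℝ EX] {HX : Type*} [TopologicalSpace HX]
  {IX : ModelWithCorners ℝ EX HX} {X : Type*} [TopologicalSpace X] [ChartedSpace HX X]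
  [IsManifold IX ∞ X] [FiniteDimensional ℝ EX]
  {EN : Type*} [NormedAddCommGroup EN] [NormedSpace ℝ EN] {HN : Type*} [TopologicalSpace HN]
  {IN : ModelWithCorners ℝ EN HN} {N : Type*} [TopologicalSpace N] [ChartedSpace HN N]
  [IsManifold IN ∞ N] [FiniteDimensional ℝ EN]

/-- **Local reparametrisation invariance of the mean curvature**: see the module docstring.
[cite: ONeill1983, Ch. 4, Lemma 4.4] -/
theorem meanCurvature_comp_right_of_bijective {f : X → M} {Ψ : N → X} {u : N}
    (hpb : contMDiff_pullbackBilin I M IX X n) (hpb' : contMDiff_pullbackBilin I M IN N n)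
    (hf : g.IsSpacelikeImmersion IX f) (hf' : g.IsSpacelikeImmersion IN (f ∘ Ψ))
    (hu : IN.IsInteriorPoint u) (hΨu : IX.IsInteriorPoint (Ψ u))
    {ν : NormalField I f}
    (hν : MDifferentiableAt IX I.tangent
      (fun x ↦ (TotalSpace.mk' E (f x) (ν x) : TangentBundle I M)) (Ψ u))
    (hΨ : MDifferentiableAt IN IX Ψ u)
    (hbij : Function.Bijective (mfderiv IN IX Ψ u)) :
    g.meanCurvature (f ∘ Ψ) hpb' hf' (fun y ↦ ν (Ψ y)) u = g.meanCurvature f hpb hf ν (Ψ u) := by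
  -- the differential of `Ψ` at `u` as a linear isomorphism
  set L : TangentSpace IN u ≃ₗ[ℝ] TangentSpace IX (Ψ u) :=
    LinearEquiv.ofBijective (mfderiv IN IX Ψ u).toLinearMap hbij with hL
  have hLe : ∀ v, L v = mfderiv IN IX Ψ u v := fun v ↦ by
    rw [hL, LinearEquiv.ofBijective_apply]; rfl
  have hfd : MDifferentiableAt IX I f (Ψ u) := (hf.contMDiff (Ψ u)).mdifferentiableAt (by simp)
  -- the two induced metrics
  set g₁ := g.inducedMetric f hpb hf with hg₁
  set g₂ := g.inducedMetric (f ∘ Ψ) hpb' hf' with hg₂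
  have hval : ∀ v w : TangentSpace IN u, g₂.val u v w = g₁.val (Ψ u) (L v) (L w) := fun v w ↦ by
    rw [hg₁, hg₂, inducedMetric_val, inducedMetric_val, inducedBilin_apply, inducedBilin_apply,
      mfderiv_comp u hfd hΨ, hLe, hLe]
    rfl
  -- an orthonormal basis at `Ψ u`, pulled back by `L`
  have hpos : ∀ v : TangentSpace IX (Ψ u), v ≠ 0 → 0 < g₁.val (Ψ u) v v :=
    fun v hv ↦ isRiemannian_inducedMetric _ _ hpb hf (Ψ u) v hv
  obtain ⟨b, hb⟩ := g₁.exists_basis_isOrthonormalFrame hpos (m := finrank ℝ EX) rfl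
  set b' : Module.Basis (Fin (finrank ℝ EX)) ℝ (TangentSpace IN u) := b.map L.symm with hb'def
  have hb'L : ∀ i, L (b' i) = b i := fun i ↦ by
    rw [hb'def, Module.Basis.map_apply]
    exact L.apply_symm_apply (b i)
  have hb' : g₂.IsOrthonormalFrame u b' :=
    ⟨fun i ↦ by rw [hval, hb'L]; exact hb.1 i,
      fun i j hij ↦ by rw [hval, hb'L, hb'L]; exact hb.2 i j hij⟩
  rw [meanCurvature, meanCurvature, ← hg₁, ← hg₂, g₂.trace_eq_sum_of_isOrthonormalFrame b' hb',
    g₁.trace_eq_sum_of_isOrthonormalFrame b hb]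
  refine Finset.sum_congr rfl fun i _ ↦ ?_
  rw [secondFundamentalForm_comp_right g hu hΨu hν hΨ (b' i) (b' i), ← hLe, hb'L]

end Literature.Geometry.Riemannian
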